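import Summits.NavierStokesRegularity.FluidComputer.PalasekTowerRingPusherSign
import Summits.NavierStokesRegularity.FluidComputer.PalasekTowerGermHostFarFieldSign
import HarnessLib

/-!
# The strict-anchor integral is ODD under the mirror `z ↦ −z`: the ring pusher placed BELOW the blob gives a
# NEGATIVE far-field anchor number (Negative lane, `EpisodeBaseT`, line «doormirror», stub D2a `SterileSmallCarrierT`)

Cell `ns-blowup`, seat `ns-blowup-refuter4` (g12; D-0074 GROUP C «BRIDGE SUPPORT», Negative lane (α)). Route
`PalasekTowerBreakdown` (rev 19), crux stmt-NavierStokesRegularity-20303 `EpisodeBaseT`, strategist's line `doormirror`,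
stub D2a `SterileSmallCarrierT` (a swirl-free, axisymmetric level-0 carrier passing the STRICT anchor face
`0 < ⟪U x₀, accel ν U x₀⟫` at the speed argmax). The positive half of that stub is `ns-blowup-fc-prover-2`'s
`exists_ringPusher_anchor_integral_pos` (p564714): for a thin pancake ring `P_δ` centred at height `z = +5` ABOVE the
origin, `0 < ∫ D³Γ(0 − x)(μP_δ x, μP_δ x, c e₃) dx` for every `μ ≠ 0`, `c > 0` — by `anchor_test_iff_fderiv3` (p450530)
exactly the far-field pressure number that makes the blob `c e₃` at the origin pass the strict anchor.

This file records, as kernel facts, that the PLACEMENT SIDE is load-bearing: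

* `integral_anchorIntegrand_mirror` — for ANY field `P` with `P 0 = 0`, the mirrored field `P♭ x := M (P (M x))`
  (`M = mirrorZ : (x₀, x₁, x₂) ↦ (x₀, x₁, −x₂)`, a linear isometry equivalence) has the OPPOSITE anchor number against
  `c e₃`: `∫ D³Γ(0 − x)(P♭ x, P♭ x, c e₃) dx = −∫ D³Γ(0 − x)(P x, P x, c e₃) dx`. Mechanism: the explicit third
  derivative `fderiv3_newtonKernel_apply` (p-DipoleCone) is `O(3)`-equivariant, every term carries exactly ONE factor
  `⟪·, e₃⟫`, and `M e₃ = −e₃`; the change of variables `x ↦ M x` preserves Lebesgue measure.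
* `exists_mirrorRingPusher_anchor_integral_neg` — hence, with the SAME thinness `δ` as p564714, the mirrored ring pusher
  `mirrorRingPusher δ` (the same device placed at height `z = −5`, BELOW the blob) gives a STRICTLY NEGATIVE anchor
  integral for every `μ ≠ 0`, `c > 0`; and it is an equally admissible sterile device: axisymmetric
  (`isAxisymmetric_mirrorRingPusher`), swirl-free (`hasNoSwirl_mirrorRingPusher`), divergence-free
  (`isDivFree_mirrorRingPusher`), smooth, vanishing on `‖x‖ < 9/2` (so disjoint from any blob in `‖x‖ ≤ 1`).

Reading for D2a: the sign of the far-field anchor number is NOT a property of "a small sterile ring far from the blob" —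
it is fixed by the side of the blob on which the ring sits relative to the blob's direction `U(0) = c e₃` (above: `+`,
below: `−`; the quadrupole gradient is odd in the placement side and even in `μ`). A D2a carrier must therefore place
the ring on the `+e₃` side of the speed argmax (as fc-prover-2's `sterileCarrierAt` does); the mirrored carrier
`blob + μ • mirrorRingPusher δ` FAILS the strict anchor whenever `−ν ⟪U₁ 0, ΔU₁ 0⟫ ≥ 0` (automatic at a maximum of
`‖U₁‖`), by `anchor_test_iff_fderiv3`.

LABEL: kernel analysis (theorems + two transparent helper definitions `mirrorZ`, `mirrorRingPusher`, `anchorIntegrand`).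
WHAT THIS IS NOT: not Navier–Stokes evidence; not a refutation of D2a or of any route item — a sign/symmetry fact about
ONE explicit family of compactly supported profiles; no flow, stage, schedule or certificate; sorry-free, std axioms.
bears_on: LADDER-NS N1 (route-NavierStokesRegularity-PalasekTowerBreakdown), item 20303, stub D2a.

References: A. J. Majda, A. L. Bertozzi (CUP 2002) §1.8 Prop. 1.16 (the pressure Hessian as a singular integral)
[cite: MajdaBertozziCUP2002, §1.8 Prop. 1.16]; D. Gilbarg, N. S. Trudinger (2001), (2.13) (derivatives of the
Newtonian potential) [cite: GilbargTrudinger2001, (2.13)].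
-/

noncomputable section

open Literature.Analysis.FluidPDE
open Summit.NavierStokesRegularity.FluidComputer.PalasekTowerClayBridge
open Summit.NavierStokesRegularity.FluidComputer.PalasekTowerClayBridge.TinyBlob
open Summit.NavierStokesRegularity.FluidComputer.PalasekTowerClayBridge.Germ
open MeasureTheory InnerProductSpace WithLp
open scoped RealInnerProductSpace ContDiff Laplacian

-- nested operator types `ℝ³ →L[ℝ] ℝ³ →L[ℝ] ℝ` (third derivatives of the Newtonian kernel)
set_option maxSynthPendingDepth 3

namespace Summit.NavierStokesRegularity.EpisodeBaseTRingPusherMirrorAnchorSign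

/-! ## §1 The mirror `z ↦ −z` as a linear isometry equivalence -/

/-- The mirror across the plane `{x₂ = 0}`: `M (x₀, x₁, x₂) = (x₀, x₁, −x₂)`, packaged as a linear isometry
equivalence of `ℝ³` (same map as the tree's `reflC 2` / `reflectZ`, packaged like `reflY`). [folklore] -/
def mirrorZ : EuclideanSpace ℝ (Fin 3) ≃ₗᵢ[ℝ] EuclideanSpace ℝ (Fin 3) where
  toFun x := toLp 2 ![x 0, x 1, -x 2]
  invFun x := toLp 2 ![x 0, x 1, -x 2]
  map_add' y z := by
    ext i; fin_cases i <;> simp; ring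
  map_smul' c y := by
    ext i; fin_cases i <;> simp
  left_inv y := by
    ext i; fin_cases i <;> simp
  right_inv y := by
    ext i; fin_cases i <;> simp
  norm_map' x := by
    rw [EuclideanSpace.norm_eq, EuclideanSpace.norm_eq]
    congr 1
    simp [Fin.sum_univ_three]

/-- `(M x)₀ = x₀`. [folklore] -/
@[simp] theorem mirrorZ_apply_zero (x : EuclideanSpace ℝ (Fin 3)) : mirrorZ x 0 = x 0 := rfl

/-- `(M x)₁ = x₁`. [folklore] -/
@[simp] theorem mirrorZ_apply_one (x : EuclideanSpace ℝ (Fin 3)) : mirrorZ x 1 = x 1 := rfl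

/-- `(M x)₂ = −x₂`. [folklore] -/
@[simp] theorem mirrorZ_apply_two (x : EuclideanSpace ℝ (Fin 3)) : mirrorZ x 2 = -x 2 := rfl

/-- `M` is an involution. [folklore] -/
@[simp] theorem mirrorZ_mirrorZ (x : EuclideanSpace ℝ (Fin 3)) : mirrorZ (mirrorZ x) = x := by
  ext i; fin_cases i <;> simp

/-- `M⁻¹ = M`. [folklore] -/
@[simp] theorem mirrorZ_symm : mirrorZ.symm = mirrorZ := rfl

/-- `M` reverses the axis direction in the inner product: `⟪M x, e₃⟫ = −⟪x, e₃⟫`. [folklore] -/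
theorem inner_mirrorZ_e₃ (x : EuclideanSpace ℝ (Fin 3)) : ⟪mirrorZ x, e₃⟫ = -⟪x, e₃⟫ := by
  simp [e₃, EuclideanSpace.inner_single_right]

/-- `M` commutes with the rotations about the axis. [folklore] -/
theorem mirrorZ_rotZ (θ : ℝ) (x : EuclideanSpace ℝ (Fin 3)) : mirrorZ (rotZ θ x) = rotZ θ (mirrorZ x) := by
  ext i; fin_cases i <;> simp

/-! ## §2 The third derivative of the Newtonian kernel is odd under the mirror when tested against `e₃` -/

/-- **Mirror oddness of `D³Γ` against the axis**: for `z ≠ 0`,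
`D³Γ(M z)(M a, M a, c e₃) = −D³Γ(z)(a, a, c e₃)` — every term of the explicit formula
`fderiv3_newtonKernel_apply` contains exactly one inner product with `c e₃`, which changes sign under `M`, while
`⟪M z, M a⟫ = ⟪z, a⟫`, `‖M z‖ = ‖z‖`. [cite: GilbargTrudinger2001, (2.13)] -/
theorem fderiv3_newtonKernel_mirror {z : EuclideanSpace ℝ (Fin 3)} (hz : z ≠ 0) (a : EuclideanSpace ℝ (Fin 3)) (c : ℝ) :
    fderiv ℝ (fun w => fderiv ℝ (fun w' => fderiv ℝ newtonKernel w' (mirrorZ a)) w (mirrorZ a)) (mirrorZ z) (c • e₃) =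
      -fderiv ℝ (fun w => fderiv ℝ (fun w' => fderiv ℝ newtonKernel w' a) w a) z (c • e₃) := by
  have hz' : mirrorZ z ≠ 0 := by
    rw [Ne, ← norm_eq_zero, mirrorZ.norm_map, norm_eq_zero]; exact hz
  rw [fderiv3_newtonKernel_apply hz', fderiv3_newtonKernel_apply hz]
  have h1 : ⟪mirrorZ z, mirrorZ a⟫ = ⟪z, a⟫ := mirrorZ.inner_map_map z a
  have h2 : ⟪mirrorZ z, c • e₃⟫ = -⟪z, c • e₃⟫ := by
    rw [real_inner_smul_right, real_inner_smul_right, inner_mirrorZ_e₃]; ring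
  have h3 : ⟪mirrorZ a, c • e₃⟫ = -⟪a, c • e₃⟫ := by
    rw [real_inner_smul_right, real_inner_smul_right, inner_mirrorZ_e₃]; ring
  have h4 : ⟪mirrorZ a, mirrorZ a⟫ = ⟪a, a⟫ := mirrorZ.inner_map_map a a
  have h5 : ‖mirrorZ z‖ = ‖z‖ := mirrorZ.norm_map z
  rw [h1, h2, h3, h4, h5]
  ring

/-! ## §3 The strict-anchor integrand and its mirror oddness -/

/-- The strict-anchor integrand of a field `P` at the origin, tested against `c e₃`:
`x ↦ D³Γ(0 − x)(P x, P x, c e₃)` (the integrand of `anchor_test_iff_fderiv3` at `x₀ = 0`, `U₁ 0 = c e₃`). [folklore] -/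
def anchorIntegrand (P : EuclideanSpace ℝ (Fin 3) → EuclideanSpace ℝ (Fin 3)) (c : ℝ) (x : EuclideanSpace ℝ (Fin 3)) : ℝ :=
  fderiv ℝ (fun w => fderiv ℝ (fun w' => fderiv ℝ newtonKernel w' (P x)) w (P x))
    ((0 : EuclideanSpace ℝ (Fin 3)) - x) (c • e₃)

/-- **Pointwise mirror oddness**: for `P 0 = 0`, the anchor integrand of the mirrored field `x ↦ M (P (M x))` at `x`
is MINUS the anchor integrand of `P` at `M x`. [folklore] -/
theorem anchorIntegrand_mirror (P : EuclideanSpace ℝ (Fin 3) → EuclideanSpace ℝ (Fin 3)) (hP0 : P 0 = 0) (c : ℝ)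
    (x : EuclideanSpace ℝ (Fin 3)) :
    anchorIntegrand (fun y => mirrorZ (P (mirrorZ y))) c x = -anchorIntegrand P c (mirrorZ x) := by
  unfold anchorIntegrand
  by_cases hx : x = 0
  · subst hx
    simp [hP0]
  · have hMx : mirrorZ x ≠ 0 := by
      rw [Ne, ← norm_eq_zero, mirrorZ.norm_map, norm_eq_zero]; exact hx
    have hz : (0 : EuclideanSpace ℝ (Fin 3)) - mirrorZ x ≠ 0 := by
      rw [zero_sub, neg_ne_zero]; exact hMx
    have key := fderiv3_newtonKernel_mirror hz (P (mirrorZ x)) c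
    have hM : mirrorZ ((0 : EuclideanSpace ℝ (Fin 3)) - mirrorZ x) = 0 - x := by
      rw [map_sub, map_zero, mirrorZ_mirrorZ]
    rw [hM] at key
    exact key

/-- **Mirror oddness of the strict-anchor integral**: for every field `P` with `P 0 = 0`,
`∫ D³Γ(0 − x)(P♭ x, P♭ x, c e₃) dx = −∫ D³Γ(0 − x)(P x, P x, c e₃) dx`, `P♭ = M ∘ P ∘ M`
(pointwise oddness + the measure-preserving change of variables `x ↦ M x`). [cite: MajdaBertozziCUP2002, §1.8 Prop. 1.16] -/
theorem integral_anchorIntegrand_mirror (P : EuclideanSpace ℝ (Fin 3) → EuclideanSpace ℝ (Fin 3)) (hP0 : P 0 = 0)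
    (c : ℝ) :
    ∫ x, anchorIntegrand (fun y => mirrorZ (P (mirrorZ y))) c x = -∫ x, anchorIntegrand P c x := by
  have h1 : (fun x => anchorIntegrand (fun y => mirrorZ (P (mirrorZ y))) c x) =
      fun x => -anchorIntegrand P c (mirrorZ x) :=
    funext fun x => anchorIntegrand_mirror P hP0 c x
  rw [h1, integral_neg, mirrorZ.measurePreserving.integral_comp mirrorZ.toHomeomorph.measurableEmbedding
    (fun y => anchorIntegrand P c y)]

/-! ## §4 The mirrored ring pusher: an equally sterile device with a NEGATIVE anchor integral -/

/-- **The mirrored ring pusher** `P♭_δ x := M (P_δ (M x))`: the ring pusher of `PalasekTowerRingPusher` reflected to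
height `z = −5` (below the origin). [folklore] -/
def mirrorRingPusher (δ : ℝ) (x : EuclideanSpace ℝ (Fin 3)) : EuclideanSpace ℝ (Fin 3) :=
  mirrorZ (ringPusher δ (mirrorZ x))

/-- The mirrored ring pusher is swirl-free. [folklore] -/
theorem hasNoSwirl_mirrorRingPusher (δ : ℝ) : HasNoSwirl (mirrorRingPusher δ) := fun x => by
  have h := hasNoSwirl_ringPusher δ (mirrorZ x)
  simp only [swirl, mirrorZ_apply_zero, mirrorZ_apply_one] at h
  simp only [swirl, mirrorRingPusher, mirrorZ_apply_zero, mirrorZ_apply_one]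
  exact h

/-- The mirrored ring pusher is axisymmetric (`M` commutes with the rotations about the axis). [folklore] -/
theorem isAxisymmetric_mirrorRingPusher (δ : ℝ) : IsAxisymmetric (mirrorRingPusher δ) := fun θ x => by
  simp only [mirrorRingPusher]
  rw [mirrorZ_rotZ, isAxisymmetric_ringPusher δ θ (mirrorZ x), mirrorZ_rotZ]

/-- The mirrored ring pusher is divergence free. [folklore] -/
theorem isDivFree_mirrorRingPusher (δ : ℝ) : VectorCalculus.IsDivFree (mirrorRingPusher δ) := by
  have h := (isDivFree_ringPusher δ).conj_linearIsometryEquiv mirrorZ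
  rw [mirrorZ_symm] at h
  exact h

/-- The mirrored ring pusher is smooth. [folklore] -/
theorem contDiff_mirrorRingPusher (δ : ℝ) : ContDiff ℝ ∞ (mirrorRingPusher δ) :=
  mirrorZ.toContinuousLinearEquiv.contDiff.comp
    ((contDiff_ringPusher δ).comp mirrorZ.toContinuousLinearEquiv.contDiff)

/-- The mirrored ring pusher vanishes on the ball `‖x‖ < 9/2` (in particular at the origin and on any blob in
`‖x‖ ≤ 1`). [folklore] -/
theorem mirrorRingPusher_eq_zero_of_norm_lt {δ : ℝ} (hδ : 0 < δ) (hδ4 : δ ≤ 1 / 4)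
    {x : EuclideanSpace ℝ (Fin 3)} (hx : ‖x‖ < 9 / 2) : mirrorRingPusher δ x = 0 := by
  have hx' : ‖mirrorZ x‖ < 9 / 2 := by rwa [mirrorZ.norm_map]
  simp [mirrorRingPusher, ringPusher_eq_zero_of_norm_lt hδ hδ4 hx']

/-- The mirrored ring pusher lives BELOW the origin: where it is non-zero, `x₂ ≤ −9/2`. [folklore] -/
theorem apply_two_le_of_mirrorRingPusher_ne_zero {δ : ℝ} (hδ : 0 < δ) (hδ4 : δ ≤ 1 / 4)
    {x : EuclideanSpace ℝ (Fin 3)} (hx : mirrorRingPusher δ x ≠ 0) : x 2 ≤ -(9 / 2) := by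
  have hmem : mirrorZ x ∈ ringRegion := by
    by_contra h
    exact hx (by simp [mirrorRingPusher, ringPusher_eq_zero_of_notMem hδ hδ4 h])
  have h2 : 9 / 2 ≤ mirrorZ x 2 := hmem.2.1
  rw [mirrorZ_apply_two] at h2
  linarith

/-- **The mirrored ring pusher has a NEGATIVE strict-anchor integral** (same thinness `δ` as
`exists_ringPusher_anchor_integral_pos`): for every `μ ≠ 0` and `c > 0`,
`∫ D³Γ(0 − x)(μP♭_δ x, μP♭_δ x, c e₃) dx < 0`. By `anchor_test_iff_fderiv3` the composite
`U₁ + μ • mirrorRingPusher δ` (any even, divergence-free blob `U₁` supported in `‖x‖ < 9/2` with `U₁ 0 = c e₃` and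
`−ν ⟪U₁ 0, ΔU₁ 0⟫ ≥ 0`) therefore FAILS the strict anchor `0 < ⟪U 0, accel ν U 0⟫`: the placement side of the ring
relative to the blob's direction is load-bearing for stub D2a. [cite: MajdaBertozziCUP2002, §1.8 Prop. 1.16] -/
theorem exists_mirrorRingPusher_anchor_integral_neg :
    ∃ δ : ℝ, 0 < δ ∧ δ ≤ 1 / 4 ∧ ∀ μ c : ℝ, μ ≠ 0 → 0 < c →
      ∫ x, fderiv ℝ (fun w => fderiv ℝ (fun w' => fderiv ℝ newtonKernel w' ((μ • mirrorRingPusher δ) x)) w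
        ((μ • mirrorRingPusher δ) x)) ((0 : EuclideanSpace ℝ (Fin 3)) - x) (c • e₃) < 0 := by
  obtain ⟨δ, hδ, hδ4, hpos⟩ := exists_ringPusher_anchor_integral_pos
  refine ⟨δ, hδ, hδ4, fun μ c hμ hc => ?_⟩
  have hP0 : (μ • ringPusher δ) 0 = 0 := by
    simp [ringPusher_eq_zero_of_norm_lt hδ hδ4 (by rw [norm_zero]; norm_num : ‖(0 : EuclideanSpace ℝ (Fin 3))‖ < 9 / 2)]
  have hmir : (μ • mirrorRingPusher δ) = fun x => mirrorZ ((μ • ringPusher δ) (mirrorZ x)) := by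
    funext x
    simp [mirrorRingPusher]
  have h := integral_anchorIntegrand_mirror (μ • ringPusher δ) hP0 c
  have hp : 0 < ∫ x, anchorIntegrand (μ • ringPusher δ) c x := hpos μ c hμ hc
  rw [hmir]
  show ∫ x, anchorIntegrand (fun y => mirrorZ ((μ • ringPusher δ) (mirrorZ y))) c x < 0
  rw [h]
  exact neg_neg_of_pos hp


/-! ## §5 Consequence: the mirrored sterile carrier FAILS the strict anchor -/

/-- `tsupport (mirrorRingPusher δ) ⊆ B̄(0, 7)`. [folklore] -/
theorem tsupport_mirrorRingPusher_subset_closedBall {δ : ℝ} (hδ : 0 < δ) (hδ4 : δ ≤ 1 / 4) :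
    tsupport (mirrorRingPusher δ) ⊆ Metric.closedBall (0 : EuclideanSpace ℝ (Fin 3)) 7 := by
  refine closure_minimal (fun x hx => ?_) Metric.isClosed_closedBall
  have hne : ringPusher δ (mirrorZ x) ≠ 0 := fun h => hx (by simp [mirrorRingPusher, h])
  have hmem : mirrorZ x ∈ tsupport (ringPusher δ) := subset_tsupport _ hne
  have h7 := tsupport_ringPusher_subset_closedBall hδ hδ4 hmem
  rw [Metric.mem_closedBall, dist_zero_right] at h7 ⊢
  rwa [mirrorZ.norm_map] at h7

/-- The mirrored ring pusher has compact support. [folklore] -/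
theorem hasCompactSupport_mirrorRingPusher {δ : ℝ} (hδ : 0 < δ) (hδ4 : δ ≤ 1 / 4) :
    HasCompactSupport (mirrorRingPusher δ) :=
  (isCompact_closedBall (0 : EuclideanSpace ℝ (Fin 3)) 7).of_isClosed_subset (isClosed_tsupport _)
    (tsupport_mirrorRingPusher_subset_closedBall hδ hδ4)

/-- On the support of `μ • mirrorRingPusher δ`: `9/2 ≤ ‖x‖`. [folklore] -/
theorem norm_ge_of_mem_tsupport_smul_mirrorRingPusher {δ : ℝ} (hδ : 0 < δ) (hδ4 : δ ≤ 1 / 4) (μ : ℝ)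
    {x : EuclideanSpace ℝ (Fin 3)} (hx : x ∈ tsupport (μ • mirrorRingPusher δ)) : 9 / 2 ≤ ‖x‖ := by
  have hcl : IsClosed {y : EuclideanSpace ℝ (Fin 3) | 9 / 2 ≤ ‖y‖} := isClosed_le continuous_const continuous_norm
  have hsub : Function.support (μ • mirrorRingPusher δ) ⊆ {y | 9 / 2 ≤ ‖y‖} := fun y hy => by
    by_contra hlt
    simp only [Set.mem_setOf_eq, not_le] at hlt
    exact hy (by simp [mirrorRingPusher_eq_zero_of_norm_lt hδ hδ4 hlt])
  exact closure_minimal hsub hcl hx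

/-- **THE MIRRORED STERILE CARRIER FAILS THE STRICT ANCHOR.** Let `U₁` be any smooth, compactly supported,
divergence-free blob, EVEN about the origin, supported in the ball `‖x‖ < 9/2`, with `U₁ 0 = c e₃`, `c > 0`, and
`−ν ⟪U₁ 0, ΔU₁ 0⟫ ≥ 0` (automatic for `ν ≥ 0` at a maximum of `‖U₁‖`, where `⟪U₁, ΔU₁⟫ ≤ −|∇U₁|² ≤ 0`). Then for
the thinness `δ` of `exists_mirrorRingPusher_anchor_integral_neg` and EVERY amplitude `μ ≠ 0`, the composite
`U₁ + μ • mirrorRingPusher δ` (ring BELOW the blob) does NOT pass the strict anchor face `0 < ⟪U 0, accel ν U 0⟫`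
(by `anchor_test_iff_fderiv3`, p450530). Contrast: with the ring ABOVE (`ringPusher δ`, p564714) the same blob passes.
So in stub D2a the placement side of the sterile ring relative to the direction `U(x₀)` is load-bearing.
[cite: MajdaBertozziCUP2002, §1.8 Prop. 1.16] -/
theorem not_strictAnchor_add_smul_mirrorRingPusher {ν : ℝ}
    {U₁ : EuclideanSpace ℝ (Fin 3) → EuclideanSpace ℝ (Fin 3)} (h₁ : ContDiff ℝ ∞ U₁) (h₁c : HasCompactSupport U₁)
    (hdiv₁ : VectorCalculus.IsDivFree U₁) (he : IsEvenAbout 0 U₁)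
    (hsupp : tsupport U₁ ⊆ Metric.ball (0 : EuclideanSpace ℝ (Fin 3)) (9 / 2))
    {c : ℝ} (hc : 0 < c) (hU0 : U₁ 0 = c • e₃) (hΔ : 0 ≤ -(ν * ⟪U₁ 0, (Δ U₁) 0⟫)) :
    ∃ δ : ℝ, 0 < δ ∧ δ ≤ 1 / 4 ∧ ∀ μ : ℝ, μ ≠ 0 →
      ¬ 0 < ⟪(U₁ + μ • mirrorRingPusher δ) 0, accel ν (U₁ + μ • mirrorRingPusher δ) 0⟫ := by
  obtain ⟨δ, hδ, hδ4, hneg⟩ := exists_mirrorRingPusher_anchor_integral_neg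
  refine ⟨δ, hδ, hδ4, fun μ hμ hpos => ?_⟩
  have h₂ : ContDiff ℝ ∞ (μ • mirrorRingPusher δ) := (contDiff_mirrorRingPusher δ).const_smul μ
  have h₂c : HasCompactSupport (μ • mirrorRingPusher δ) :=
    (hasCompactSupport_mirrorRingPusher hδ hδ4).comp_left (g := fun v : EuclideanSpace ℝ (Fin 3) => μ • v)
      (smul_zero μ)
  have hdiv₂ : VectorCalculus.IsDivFree (μ • mirrorRingPusher δ) :=
    VectorCalculus.IsDivFree.const_smul ((contDiff_mirrorRingPusher δ).differentiable (by simp))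
      (isDivFree_mirrorRingPusher δ) μ
  have hd : Disjoint (tsupport U₁) (tsupport (μ • mirrorRingPusher δ)) :=
    Set.disjoint_left.2 fun x hx₁ hx₂ =>
      (not_le.2 (mem_ball_zero_iff.1 (hsupp hx₁))) (norm_ge_of_mem_tsupport_smul_mirrorRingPusher hδ hδ4 μ hx₂)
  have hfar : ∀ x ∈ tsupport (μ • mirrorRingPusher δ), (4 : ℝ) < ‖(0 : EuclideanSpace ℝ (Fin 3)) - x‖ :=
    fun x hx => by
    rw [zero_sub, norm_neg]
    linarith [norm_ge_of_mem_tsupport_smul_mirrorRingPusher hδ hδ4 μ hx]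
  have hlt : ∫ x, fderiv ℝ (fun w => fderiv ℝ (fun w' => fderiv ℝ newtonKernel w' ((μ • mirrorRingPusher δ) x)) w
      ((μ • mirrorRingPusher δ) x)) ((0 : EuclideanSpace ℝ (Fin 3)) - x) (U₁ 0) < 0 := by
    rw [hU0]
    exact hneg μ c hμ hc
  have h1 := (anchor_test_iff_fderiv3 (ν := ν) h₁ h₁c hdiv₁ he h₂ h₂c hdiv₂ hd (by norm_num : (0 : ℝ) < 4) hfar).1 hpos
  linarith

end Summit.NavierStokesRegularity.EpisodeBaseTRingPusherMirrorAnchorSign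

end
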